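import Summits.BirchSwinnertonDyer.BirchSwinnertonDyer.Theorems.DefiniteThetaDerivedHeightCapTowerSqrtAnyPrimeTowerKernels
import Summits.BirchSwinnertonDyer.BirchSwinnertonDyer.Theorems.DefiniteThetaDerivedHeightCapTowerSqrtAcLayerCyclic
import Mathlib.Tactic.Module
import HarnessLib

/-!
# The anticyclotomic layer groups `Pic(𝒪_{p^m})/Δ` are CYCLIC `p`-groups of unbounded order — for EVERY prime `p`

Route-independent `Theorems` file (cell `b2b-bsdres`, seat `b2b-bsdres-x10b`, gen 45), part 13 of the series «tower square root»
serving crux `DerivedHeightCap` (stmt-BirchSwinnertonDyer-18438, route DefiniteTheta), registered stub `stub_towerSqrt`.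
HONEST FRAMING: no curve asserted, no class closed, BSD not proved by any of this.

`K` imaginary quadratic, `p` ANY prime; `G̃_m = Pic(𝒪_{p^m})`, `Δ_m = torsionImage K p m`, `Q_m = AcLayerGroup K p m = G̃_m/Δ_m`. This is
part 6 in the uniform generality `p ≠ 2 ∨ 1 ≤ k` of parts 11–12 (at `p = 2` the base level `k + 1` is `≥ 2`):

* §1 `exists_good_mul_pow_inv_of_ne_two_or` (dichotomy at a bad level), `exists_ptorsion_generator_of_ne_two_or` (the `p`-torsion of
  `Q_{k+1}` is generated by one class), **`exists_generator_mod_torsionImage_of_ne_two_or`: `Q_{k+1}` is CYCLIC** (`G̃_{k+1} = ⟨c⟩·Δ_{k+1}`).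
* §2 `orderOf_kernel_generator_of_ne_two_or`, `exists_pow_prime_pow_not_mem_three`: an element of order `p^{k+1}` modulo `Δ` in
  `G̃_{k+3}` (base level `2`, every prime) — unbounded layer orders, `Q_3 ≠ 1`.
Levels `1` (and `2` at `p = 2`) are reached in part 14 by pushing generators DOWN the (onto) restriction maps.

## References
* [BertoliniDarmon2005] §1.2 (18)–(21); [DarmonIovita2008] §2.2; [Washington1997] §13.2.
-/

noncomputable section

open scoped BigOperators

-- D-0017: single-problem summit, the namespace repeats the problem name by design.
set_option linter.dupNamespace false

namespace Summit.BirchSwinnertonDyer.BirchSwinnertonDyer.Theorems.TowerSqrt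

open Literature.NumberTheory.EllipticCurves Literature.NumberTheory.EllipticCurves.QuadOrderTower NumberField
open Summit.BirchSwinnertonDyer.BirchSwinnertonDyer.Theorems.DefmuSupersingularTheta
  (picRes_mem_torsionImage picRes_surjective_tower pow_pow_eq_one_of_picRes_eq_one_tower)

universe u

variable {K : Type u} [Field K] [NumberField K] (p : ℕ) [hp : Fact p.Prime]

/-! ### §1 Dichotomy, `p`-torsion generator, cyclicity -/

/-- **Dichotomy at a bad level.** `K` imaginary quadratic, `p` any prime with `p ≠ 2 ∨ 1 ≤ k`, `M = k+2+j`. Let `x₁, x₂ ∈ G̃_{k+1}` with `x₁^p, x₂^p ∈ Δ_{k+1}`,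
and suppose `M` is NOT good for `x₁` (no lift `y` of `x₁` to `G̃_M` has `y^p ∈ Δ_M`). Then for some `0 ≤ i < p` the level `M` IS
good for `x₂ x₁^{-i}`. (With `N_{M,k+1} = ⟨h⟩` (part 12 §1), lifts `x_{ℓ,M}` and `t'_ℓ ∈ Δ_M` over `x_ℓ^p`: the defects
`x_{ℓ,M}^p t'^{-1}_ℓ = h^{a_ℓ}`; badness means `p ∤ a₁`, so `a₂ ≡ i a₁ (mod p)` is solvable and `h^{a₂ − i a₁}` is a `p`-th power
in `⟨h⟩`.) [cite: BertoliniDarmon2005, §1.2 (18)–(21)] -/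
theorem exists_good_mul_pow_inv_of_ne_two_or (hK : IsImaginaryQuadratic K) (k j M : ℕ) (hpk : p ≠ 2 ∨ 1 ≤ k)
    (hM : M = k + 2 + j)
    (x₁ x₂ : ClassGroup (quadOrder K (p ^ (k + 1))))
    (hx₁ : x₁ ^ p ∈ torsionImage K p (k + 1)) (hx₂ : x₂ ^ p ∈ torsionImage K p (k + 1))
    (hbad : ¬ ∃ y : ClassGroup (quadOrder K (p ^ M)), picRes K (pow_dvd_pow p (by omega : k + 1 ≤ M)) y = x₁ ∧
      y ^ p ∈ torsionImage K p M) :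
    ∃ i : ℕ, i < p ∧ ∃ y : ClassGroup (quadOrder K (p ^ M)),
      picRes K (pow_dvd_pow p (by omega : k + 1 ≤ M)) y = x₂ * (x₁ ^ i)⁻¹ ∧ y ^ p ∈ torsionImage K p M := by
  haveI : NeZero p := ⟨hp.out.ne_zero⟩
  -- kernel generator, lifts, torsion lifts
  obtain ⟨h, hh1, hh2⟩ := exists_kernel_generator p hK k j M hM
  obtain ⟨X₁, hX₁⟩ := picRes_surjective_tower p hK (j + 1) k M (by omega) x₁
  obtain ⟨X₂, hX₂⟩ := picRes_surjective_tower p hK (j + 1) k M (by omega) x₂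
  obtain ⟨t₁, ht₁, ht₁x⟩ := exists_mem_torsionImage_picRes_eq_tower p k (j + 1) M (by omega) hx₁
  obtain ⟨t₂, ht₂, ht₂x⟩ := exists_mem_torsionImage_picRes_eq_tower p k (j + 1) M (by omega) hx₂
  -- the defects lie in the kernel `N_{M,k+1} ⊆ ⟨h⟩`
  have hker : ∀ (X t : ClassGroup (quadOrder K (p ^ M))) (x : ClassGroup (quadOrder K (p ^ (k + 1)))),
      picRes K (pow_dvd_pow p (by omega : k + 1 ≤ M)) X = x →
      picRes K (pow_dvd_pow p (by omega : k + 1 ≤ M)) t = x ^ p →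
      ∃ a : ℤ, X ^ (p : ℤ) = h ^ a * t := by
    intro X t x hX ht
    have h1 : picRes K (pow_dvd_pow p (by omega : k + 1 ≤ M)) (X ^ p * t⁻¹) = 1 := by
      rw [map_mul, map_inv, map_pow, hX, ht, mul_inv_cancel]
    obtain ⟨a, ha⟩ := Subgroup.mem_zpowers_iff.mp (ker_le_zpowers_of_ne_two_or p hK k j hpk M hM h hh1 hh2 _ h1)
    exact ⟨a, by rw [zpow_natCast, ha, inv_mul_cancel_right]⟩
  obtain ⟨a₁, ha₁⟩ := hker X₁ t₁ x₁ hX₁ ht₁x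
  obtain ⟨a₂, ha₂⟩ := hker X₂ t₂ x₂ hX₂ ht₂x
  -- powers of h restrict to 1
  have hres_zpowers : ∀ ν ∈ Subgroup.zpowers h, picRes K (pow_dvd_pow p (by omega : k + 1 ≤ M)) ν = 1 := by
    intro ν hν
    obtain ⟨b, rfl⟩ := Subgroup.mem_zpowers_iff.mp hν
    rw [map_zpow, hh1, one_zpow]
  -- badness: p ∤ a₁
  have hpa₁ : ¬ (p : ℤ) ∣ a₁ := by
    intro hdvd
    obtain ⟨ν, hν, hνp⟩ := (zpow_prime_pow_eq_one_iff_dvd_of_ne_two_or p hK k j hpk M hM h hh1 hh2 a₁).mpr hdvd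
    apply hbad
    refine ⟨X₁ * ν⁻¹, by rw [map_mul, map_inv, hX₁, hres_zpowers ν hν, inv_one, mul_one], ?_⟩
    have : (X₁ * ν⁻¹) ^ p = t₁ := by
      rw [mul_pow, inv_pow, ← zpow_natCast X₁, ha₁, hνp]
      apply (Additive.ofMul (α := ClassGroup (quadOrder K (p ^ M)))).injective
      simp only [ofMul_mul, ofMul_inv, ofMul_zpow]
      module
    rw [this]; exact ht₁
  -- solve a₂ ≡ i a₁ (mod p) with 0 ≤ i < p
  have hprime : Prime (p : ℤ) := Nat.prime_iff_prime_int.mp hp.out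
  obtain ⟨u, v, huv⟩ := (Prime.coprime_iff_not_dvd hprime).mpr hpa₁
  set i₀ : ℤ := a₂ * v with hi₀
  have hp0 : (0 : ℤ) < p := by exact_mod_cast hp.out.pos
  set i : ℕ := (i₀ % p).toNat with hi
  have hi_cast : (i : ℤ) = i₀ % p := Int.toNat_of_nonneg (Int.emod_nonneg _ hp0.ne')
  have hi_lt : i < p := by
    have : (i : ℤ) < p := by rw [hi_cast]; exact Int.emod_lt_of_pos _ hp0
    exact_mod_cast this
  have hdvd : (p : ℤ) ∣ a₂ - i * a₁ := by
    have e1 : a₂ - i * a₁ = p * (a₂ * u + (i₀ / p) * a₁) := by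
      have hmod : (i : ℤ) = i₀ - p * (i₀ / p) := by rw [hi_cast, Int.emod_def]
      rw [hmod]
      linear_combination (-a₂) * huv
    exact ⟨_, e1⟩
  obtain ⟨ν, hν, hνp⟩ := (zpow_prime_pow_eq_one_iff_dvd_of_ne_two_or p hK k j hpk M hM h hh1 hh2 (a₂ - i * a₁)).mpr hdvd
  refine ⟨i, hi_lt, X₂ * (X₁ ^ (i : ℤ))⁻¹ * ν⁻¹, ?_, ?_⟩
  · rw [map_mul, map_mul, map_inv, map_inv, map_zpow, hX₂, hX₁, hres_zpowers ν hν, inv_one, mul_one, zpow_natCast]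
  · have hP : (X₂ * (X₁ ^ (i : ℤ))⁻¹ * ν⁻¹) ^ p = t₂ * (t₁ ^ (i : ℤ))⁻¹ := by
      rw [← zpow_natCast, mul_inv_inv_zpow_eq]
      exact defect_cancel h t₁ t₂ (X₁ ^ (p : ℤ)) (X₂ ^ (p : ℤ)) (ν ^ (p : ℤ)) a₁ a₂ i ha₁ ha₂
        (by rw [zpow_natCast]; exact hνp)
    rw [hP]
    exact Subgroup.mul_mem _ ht₂ (Subgroup.inv_mem _ (Subgroup.zpow_mem _ ht₁ _))

/-- **The `p`-torsion of `G̃_{k+1}/Δ` is generated by one class**: there is `x₁` with `x₁^p ∈ Δ` such that every `x₂` with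
`x₂^p ∈ Δ` satisfies `x₂ x₁^{-i} ∈ Δ` for some `0 ≤ i < p` (every prime `p`, `p ≠ 2 ∨ 1 ≤ k`). If some such `x₁ ∉ Δ` exists, it has a bad level (part 12 §3), bad
levels are upward closed, and the `x₂ x₁^{-i}` (`i < p`) cannot all have a bad level (take the maximum; §2); otherwise `x₁ = 1` does.
[cite: BertoliniDarmon2005, §1.2 (18)–(21)] -/
theorem exists_ptorsion_generator_of_ne_two_or (hK : IsImaginaryQuadratic K) (k : ℕ) (hpk : p ≠ 2 ∨ 1 ≤ k) :
    ∃ x₁ : ClassGroup (quadOrder K (p ^ (k + 1))), x₁ ^ p ∈ torsionImage K p (k + 1) ∧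
      ∀ x₂ : ClassGroup (quadOrder K (p ^ (k + 1))), x₂ ^ p ∈ torsionImage K p (k + 1) →
        ∃ i : ℕ, i < p ∧ x₂ * (x₁ ^ i)⁻¹ ∈ torsionImage K p (k + 1) := by
  classical
  by_cases hnt : ∃ x₁ : ClassGroup (quadOrder K (p ^ (k + 1))), x₁ ^ p ∈ torsionImage K p (k + 1) ∧
      x₁ ∉ torsionImage K p (k + 1)
  · obtain ⟨x₁, hx₁p, hx₁⟩ := hnt
    refine ⟨x₁, hx₁p, fun x₂ hx₂p => ?_⟩
    -- a bad level for x₁, and all higher levels are bad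
    have hbad₁ : ∃ j₀ : ℕ, ∀ j M (hM : M = k + 2 + j), j₀ ≤ j →
        ¬ ∃ y : ClassGroup (quadOrder K (p ^ M)), picRes K (pow_dvd_pow p (by omega : k + 1 ≤ M)) y = x₁ ∧
          y ^ p ∈ torsionImage K p M := by
      by_contra hcon
      push Not at hcon
      apply hx₁
      refine mem_torsionImage_of_forall_lift_of_ne_two_or p hK k hpk x₁ fun j M hM => ?_
      obtain ⟨j', M', hM', hjj', hgood⟩ := hcon j
      exact good_of_le p k M' M (by omega) (by omega) x₁ hgood
    obtain ⟨j₀, hj₀⟩ := hbad₁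
    by_contra hcon
    push Not at hcon
    -- each x₂ x₁^{-i} (i < p) is outside Δ, hence has a bad level j_i (upward closed)
    have hbad₂ : ∀ i : Fin p, ∃ j : ℕ, ∀ j' M (hM : M = k + 2 + j'), j ≤ j' →
        ¬ ∃ y : ClassGroup (quadOrder K (p ^ M)),
          picRes K (pow_dvd_pow p (by omega : k + 1 ≤ M)) y = x₂ * (x₁ ^ (i : ℕ))⁻¹ ∧ y ^ p ∈ torsionImage K p M := by
      intro i
      by_contra hc
      push Not at hc
      apply hcon i i.isLt
      refine mem_torsionImage_of_forall_lift_of_ne_two_or p hK k hpk _ fun j M hM => ?_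
      obtain ⟨j', M', hM', hjj', hgood⟩ := hc j
      exact good_of_le p k M' M (by omega) (by omega) _ hgood
    choose jf hjf using hbad₂
    -- a common bad level contradicts the dichotomy
    set J := max j₀ (Finset.univ.sup jf) with hJ
    have hJ₀ : j₀ ≤ J := le_max_left _ _
    have hJi : ∀ i : Fin p, jf i ≤ J := fun i => (Finset.le_sup (Finset.mem_univ i)).trans (le_max_right _ _)
    obtain ⟨i, hi, y, hy, hyp⟩ := exists_good_mul_pow_inv_of_ne_two_or p hK k J (k + 2 + J) hpk rfl x₁ x₂ hx₁p hx₂p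
      (hj₀ J (k + 2 + J) rfl hJ₀)
    exact hjf ⟨i, hi⟩ J (k + 2 + J) rfl (hJi ⟨i, hi⟩) ⟨y, hy, hyp⟩
  · -- no `p`-torsion outside Δ: x₁ = 1
    push Not at hnt
    refine ⟨1, by rw [one_pow]; exact Subgroup.one_mem _, fun x₂ hx₂p => ⟨0, hp.out.pos, ?_⟩⟩
    rw [pow_zero, inv_one, mul_one]
    exact hnt x₂ hx₂p

/-- **`G̃_{k+1} = ⟨c⟩ · Δ_{k+1}`: the layer group `Pic(𝒪_{p^{k+1}})/Δ` is CYCLIC** (`K` imaginary quadratic, every prime `p`, `p ≠ 2 ∨ 1 ≤ k`) — stated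
without the quotient: some class `c` generates `Pic(𝒪_{p^{k+1}})` modulo `Δ`. Proof in the quotient `Q = G̃/Δ`: a finite commutative
`p`-group (part 5 §4) whose elements killed by `p` are the `[x₁]^i`, `i < p` (§1), is cyclic (part 4 §1); these are the finite layers
of `G_∞ = G̃_∞/Δ ≅ ℤ_p`. [cite: BertoliniDarmon2005, §1.2 (18)–(21)] [cite: DarmonIovita2008, §2.2] -/
theorem exists_generator_mod_torsionImage_of_ne_two_or (hK : IsImaginaryQuadratic K) (k : ℕ) (hpk : p ≠ 2 ∨ 1 ≤ k) :
    ∃ c : ClassGroup (quadOrder K (p ^ (k + 1))), ∀ x : ClassGroup (quadOrder K (p ^ (k + 1))),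
      ∃ i : ℕ, x * (c ^ i)⁻¹ ∈ torsionImage K p (k + 1) := by
  classical
  -- local instance: keeps the typeclass search for the quotient away from `IsCyclic.isMulCommutative`
  haveI : IsMulCommutative (ClassGroup (quadOrder K (p ^ (k + 1)))) := CommMagma.to_isCommutative
  haveI : Finite (ClassGroup (quadOrder K (p ^ (k + 1)))) := finite_classGroup (K := K) _
  letI : Fintype (ClassGroup (quadOrder K (p ^ (k + 1))) ⧸ torsionImage K p (k + 1)) := Fintype.ofFinite _
  set N := torsionImage K p (k + 1) with hN
  -- at most p classes are killed by p
  obtain ⟨x₁, -, hx₁⟩ := exists_ptorsion_generator_of_ne_two_or p hK k hpk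
  have hcard : (Finset.univ.filter fun q : ClassGroup (quadOrder K (p ^ (k + 1))) ⧸ N => q ^ p = 1).card ≤ p := by
    have hsub : (Finset.univ.filter fun q : ClassGroup (quadOrder K (p ^ (k + 1))) ⧸ N => q ^ p = 1) ⊆
        (Finset.range p).image fun i => (QuotientGroup.mk' N x₁) ^ i := by
      intro q hq
      obtain ⟨x₂, rfl⟩ := QuotientGroup.mk'_surjective N q
      rw [Finset.mem_filter, ← map_pow, QuotientGroup.mk'_apply] at hq
      obtain ⟨i, hi, hmem⟩ := hx₁ x₂ ((QuotientGroup.eq_one_iff _).mp hq.2)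
      refine Finset.mem_image.mpr ⟨i, Finset.mem_range.mpr hi, ?_⟩
      rw [← map_pow, QuotientGroup.mk'_apply, QuotientGroup.mk'_apply, QuotientGroup.eq]
      have : (x₁ ^ i)⁻¹ * x₂ = x₂ * (x₁ ^ i)⁻¹ := mul_comm _ _
      rw [this]; exact hmem
    calc _ ≤ ((Finset.range p).image fun i => (QuotientGroup.mk' N x₁) ^ i).card := Finset.card_le_card hsub
      _ ≤ (Finset.range p).card := Finset.card_image_le
      _ = p := Finset.card_range p
  have hcyc : IsCyclic (ClassGroup (quadOrder K (p ^ (k + 1))) ⧸ N) :=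
    isCyclic_of_isPGroup_of_card_le (isPGroup_acLayerGroup p hK k) hcard
  obtain ⟨g, hg⟩ := hcyc.exists_generator
  obtain ⟨c, rfl⟩ := QuotientGroup.mk'_surjective N g
  refine ⟨c, fun x => ?_⟩
  obtain ⟨i, hi⟩ := ((isOfFinOrder_of_finite _).mem_powers_iff_mem_zpowers).mpr (hg (QuotientGroup.mk' N x))
  refine ⟨i, ?_⟩
  have hi' : QuotientGroup.mk' N (c ^ i) = QuotientGroup.mk' N x := by rw [map_pow]; exact hi
  rw [QuotientGroup.mk'_apply, QuotientGroup.mk'_apply, QuotientGroup.eq] at hi'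
  have : (c ^ i)⁻¹ * x = x * (c ^ i)⁻¹ := mul_comm _ _
  rw [← this]; exact hi'

/-! ### §2 An element of order `p^{k+1}` modulo `Δ` in `G̃_{k+3}` -/

/-- The order of a kernel generator: `h ∈ N_{k+2+j, k+1}` with `res_{→k+2} h ≠ 1` has order `p^{j+1}` (every prime `p`, `p ≠ 2 ∨ 1 ≤ k`).
[cite: Cox2013, §7.D Thm. 7.24] -/
theorem orderOf_kernel_generator_of_ne_two_or (hK : IsImaginaryQuadratic K) (k j M : ℕ) (hpk : p ≠ 2 ∨ 1 ≤ k)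
    (hM : M = k + 2 + j)
    (h : ClassGroup (quadOrder K (p ^ M))) (h1 : picRes K (pow_dvd_pow p (by omega : k + 1 ≤ M)) h = 1)
    (h2 : picRes K (pow_dvd_pow p (by omega : k + 2 ≤ M)) h ≠ 1) : orderOf h = p ^ (j + 1) := by
  refine orderOf_eq_prime_pow ?_ ?_
  · exact pow_pow_ne_one_of_picRes_of_ne_two_or p hK j k hpk M hM h h1 h2
  · exact Summit.BirchSwinnertonDyer.BirchSwinnertonDyer.Theorems.DefmuSupersingularTheta.pow_pow_eq_one_of_picRes_eq_one_tower
      p hK (j + 1) k M (by omega) h h1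

/-- **An element of order `p^{k+1}` modulo `Δ` in `Pic(𝒪_{p^{k+3}})`** (every prime `p`): a generator `h` of `N_{k+3,2}` has
`h^{p^{k+1}} = 1` and `h^{p^k} ∉ Δ_{k+3}` (`⟨h⟩ ∩ Δ ⊆ N_{k+3,2} ∩ Δ = 1`, part 12 §2 with base level `2`, legal for every prime). So
`#(G̃_{k+3}/Δ) ≥ p^{k+1}`: the layer orders are unbounded, and `G̃_3/Δ ≠ 1` (at `p = 2`, `G̃_2/Δ` CAN be trivial, e.g. `K = ℚ(√-3)`).
[cite: BertoliniDarmon2005, §1.2 (18)–(21)] -/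
theorem exists_pow_prime_pow_not_mem_three (hK : IsImaginaryQuadratic K) (k : ℕ) :
    ∃ h : ClassGroup (quadOrder K (p ^ (k + 3))), h ^ p ^ (k + 1) = 1 ∧ h ^ p ^ k ∉ torsionImage K p (k + 3) := by
  obtain ⟨h, hh1, hh2⟩ := exists_kernel_generator p hK 1 k (k + 3) (by omega)
  have hord : orderOf h = p ^ (k + 1) :=
    orderOf_kernel_generator_of_ne_two_or p hK 1 k (k + 3) (Or.inr le_rfl) (by omega) h hh1 hh2
  refine ⟨h, by rw [← hord]; exact pow_orderOf_eq_one h, fun hmem => ?_⟩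
  have hres : picRes K (pow_dvd_pow p (by omega : 1 + 1 ≤ k + 3)) (h ^ p ^ k) = 1 := by
    rw [map_pow, hh1, one_pow]
  have h1 := eq_one_of_mem_torsionImage_of_picRes_eq_one_tower_of_ne_two_or p hK 1 (k + 1) (Or.inr le_rfl) (k + 3)
    (by omega) hmem hres
  have hdvd : orderOf h ∣ p ^ k := orderOf_dvd_of_pow_eq_one h1
  rw [hord] at hdvd
  exact absurd (Nat.le_of_dvd (pow_pos hp.out.pos _) hdvd)
    (not_le.mpr (Nat.pow_lt_pow_right hp.out.one_lt (Nat.lt_succ_self k)))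

end Summit.BirchSwinnertonDyer.BirchSwinnertonDyer.Theorems.TowerSqrt

end
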